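import Summits.RiemannHypothesis.RiemannHypothesis.Theorems.PfPersistenceEdgeLawLayer
import Summits.RiemannHypothesis.RiemannHypothesis.Theorems.GroundBartaPolarPerronFrobeniusFormDomainEven
import Summits.RiemannHypothesis.RiemannHypothesis.Theorems.WeilWindowFlowWindowLipschitzStubSupBound
import Summits.RiemannHypothesis.RiemannHypothesis.Theorems.WeilWindowFlowWindowLipschitzStubEulerLagrange
import HarnessLib

/-!
# Edge law — the edge layers of a Weil ground state have FINITE ENERGY (pub-rhpf theory-2, gen 4, Part C)

Mechanism/rigidity campaign; no RH claims. RH-free helper lemmas on the hypotheses of the tree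
statement `PfPersistence.WeilLogPohozaevAt` (theory-1 R6).

Part B (`PfPersistenceEdgeLawLayer`) estimates the defect energy of the edge layer
`σ_h = ũ · 1_{a − h < |x|}` of a ground state `u` of the window `a` under the hypothesis that `σ_h`
has finite archimedean energy `∫_{t > 0} ρ(t) D_t(σ_h) dt < ∞`. Here that hypothesis is DISCHARGED
for every ground state and every depth `h`, from the tree's uniform sup bound of ground states
(`WeilWindowFlowWindowLipschitz.stub_supBound`, fed with the landed finite-energy and Euler–Lagrange
stubs): with `‖u‖ ≤ K` a.e.,
`D_t(σ_h) ≤ 2 D_t(ũ) + 2 ∫_{shell_t} ‖ũ‖² ≤ 2 D_t(ũ) + 8 K² |t|`,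
where `shell_t = {a − h − |t| < |x| ≤ a − h + |t|}` contains the symmetric difference of the layer
set and its translate; against `ρ(t) ≤ 1/t` on `(0, 1]` and `ρ ∈ L¹(1, ∞)` (with `D_t ≤ 4‖σ_h‖²`)
this gives `IntegrableOn (ρ · D_·(σ_h)) (Ioi 0)`; measurability is the continuity of
`t ↦ D_t(σ_h)` (`PolarPerronFrobenius.continuous_weilIncrement_of_memLp_window`).

## References
* E. Bombieri, *Remarks on Weil's quadratic functional in the theory of prime numbers, I*,
  Rend. Mat. Acc. Lincei (9) 11 (2000) 183–233, §4 Thm 3.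
* P. A. Feulefack, S. Jarohs, T. Weth, arXiv:2010.10448, §3 (the sup bound, as used by the tree).
-/

set_option linter.dupNamespace false

noncomputable section

open MeasureTheory Set Filter
open scoped Topology

namespace Summit.RiemannHypothesis.RiemannHypothesis.Theorems.PfPersistence

open Literature.NumberTheory.LFunctions
open Summit.RiemannHypothesis.RiemannHypothesis.Theorems.WeilWindowFlowWindowLipschitz
  (stub_groundStateEnergy stub_formDomainPos stub_eulerLagrange stub_supBound
    stub_commutatorBound_measurableSet_layer stub_commutatorBound_measurableSet_shell
    stub_commutatorBound_volume_shell_ne_top stub_commutatorBound_volume_real_shell_le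
    stub_commutatorBound_rho_le_inv stub_barrierEnergy_weilIncrement_le_four)
open Summit.RiemannHypothesis.RiemannHypothesis.Theorems.PolarPerronFrobenius
  (continuous_weilIncrement_of_memLp_window)

variable {a : ℝ} {u : ℝ → ℂ}

/-! ## The sup bound at one window -/

/-- **Sup bound of a ground state** (one window): `‖u‖ ≤ K` a.e. for some `K ≥ 0` — the tree's
uniform sup bound `stub_supBound` on the range `[a, a]`, fed with the landed stubs (C1), (C2), (EL).
[cite: FeulefackJarohsWeth2020, §3 (Thm 1.1, Cor 1.4)] -/
theorem exists_ae_norm_le (hu : IsWeilGroundState a u) :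
    ∃ K : ℝ, 0 ≤ K ∧ ∀ᵐ x : ℝ, ‖u x‖ ≤ K := by
  obtain ⟨K, hK⟩ := stub_supBound stub_groundStateEnergy
    (stub_eulerLagrange stub_formDomainPos stub_groundStateEnergy) a a hu.pos le_rfl
  refine ⟨max K 0, le_max_right _ _, ?_⟩
  filter_upwards [hK a u le_rfl le_rfl hu] with x hx using hx.trans (le_max_left _ _)

/-- The truncation is pointwise dominated by the state: `‖ũ(x)‖ ≤ ‖u(x)‖`. [folklore] -/
theorem norm_weilTrunc_le (x : ℝ) : ‖weilTrunc a u x‖ ≤ ‖u x‖ :=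
  norm_indicator_le_norm_self _ _

/-! ## Increments of the layer function -/

/-- **Pointwise increment bound for the layer function.** With `shell_t = {a − h − |t| < |y| ≤
a − h + |t|}` (it contains the symmetric difference of the layer set and its `t`-translate):
`‖σ_h(x+t) − σ_h(x)‖² ≤ 2‖ũ(x+t) − ũ(x)‖² + 2 · 1_{shell_t}(x) ‖ũ(x)‖²`. [folklore] -/
theorem norm_sq_sub_weilEdgeLayer_le (h t x : ℝ) :
    ‖weilEdgeLayer a u h (x + t) - weilEdgeLayer a u h x‖ ^ 2 ≤
      2 * ‖weilTrunc a u (x + t) - weilTrunc a u x‖ ^ 2 +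
        2 * {y : ℝ | a - (h + |t|) < |y| ∧ |y| ≤ a - (h - |t|)}.indicator
          (fun y ↦ ‖weilTrunc a u y‖ ^ 2) x := by
  have hind0 : 0 ≤ {y : ℝ | a - (h + |t|) < |y| ∧ |y| ≤ a - (h - |t|)}.indicator
      (fun y ↦ ‖weilTrunc a u y‖ ^ 2) x :=
    Set.indicator_nonneg (fun _ _ ↦ by positivity) _
  have hxt1 : |x + t| ≤ |x| + |t| := abs_add_le x t
  have hxt2 : |x| ≤ |x + t| + |t| := by
    have := abs_sub (x + t) t
    rwa [add_sub_cancel_right] at this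
  by_cases hx : a - h < |x| <;> by_cases hxt : a - h < |x + t|
  · rw [weilEdgeLayer_apply_of_lt hx, weilEdgeLayer_apply_of_lt hxt]
    nlinarith [sq_nonneg ‖weilTrunc a u (x + t) - weilTrunc a u x‖]
  · -- `x` in the layer, `x + t` in the core: `x ∈ shell_t`
    rw [weilEdgeLayer_apply_of_lt hx, weilEdgeLayer_apply_of_le (not_lt.1 hxt), zero_sub,
      norm_neg]
    have hmem : x ∈ {y : ℝ | a - (h + |t|) < |y| ∧ |y| ≤ a - (h - |t|)} :=
      ⟨by linarith [abs_nonneg t], by linarith [not_lt.1 hxt]⟩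
    rw [Set.indicator_of_mem hmem]
    nlinarith [sq_nonneg ‖weilTrunc a u (x + t) - weilTrunc a u x‖, sq_nonneg ‖weilTrunc a u x‖]
  · -- `x` in the core, `x + t` in the layer: `x ∈ shell_t`, parallelogram bound
    rw [weilEdgeLayer_apply_of_le (not_lt.1 hx), weilEdgeLayer_apply_of_lt hxt, sub_zero]
    have hmem : x ∈ {y : ℝ | a - (h + |t|) < |y| ∧ |y| ≤ a - (h - |t|)} :=
      ⟨by linarith, by linarith [not_lt.1 hx, abs_nonneg t]⟩
    rw [Set.indicator_of_mem hmem]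
    have hpar : ‖weilTrunc a u (x + t)‖ ≤
        ‖weilTrunc a u (x + t) - weilTrunc a u x‖ + ‖weilTrunc a u x‖ := by
      have := norm_add_le (weilTrunc a u (x + t) - weilTrunc a u x) (weilTrunc a u x)
      rwa [sub_add_cancel] at this
    nlinarith [hpar, norm_nonneg (weilTrunc a u (x + t)),
      norm_nonneg (weilTrunc a u (x + t) - weilTrunc a u x), norm_nonneg (weilTrunc a u x),
      sq_nonneg (‖weilTrunc a u (x + t) - weilTrunc a u x‖ - ‖weilTrunc a u x‖)]
  · rw [weilEdgeLayer_apply_of_le (not_lt.1 hx), weilEdgeLayer_apply_of_le (not_lt.1 hxt),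
      sub_zero, norm_zero]
    nlinarith [sq_nonneg ‖weilTrunc a u (x + t) - weilTrunc a u x‖]

/-- **Increment bound for the layer function** under a sup bound `‖u‖ ≤ K` a.e.:
`D_t(σ_h) ≤ 2 D_t(ũ) + 8 K² |t|` (the shell has measure `≤ 4|t|`). [folklore] -/
theorem weilIncrement_weilEdgeLayer_le (hu : IsWeilGroundState a u) {K : ℝ}
    (hK : ∀ᵐ x : ℝ, ‖u x‖ ≤ K) (h t : ℝ) :
    weilIncrement (weilEdgeLayer a u h) t ≤
      2 * weilIncrement (weilTrunc a u) t + 8 * K ^ 2 * |t| := by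
  set S : Set ℝ := {y : ℝ | a - (h + |t|) < |y| ∧ |y| ≤ a - (h - |t|)} with hS
  have hSm : MeasurableSet S := stub_commutatorBound_measurableSet_shell a (h - |t|) (h + |t|)
  have hv2 : MemLp (weilTrunc a u) 2 := (isWeilGroundState_weilTrunc hu).memLp
  have hi2 : Integrable fun x ↦ ‖weilTrunc a u x‖ ^ 2 :=
    (memLp_two_iff_integrable_sq_norm hv2.1).1 hv2
  have hd2 : Integrable fun x ↦ ‖weilTrunc a u (x + t) - weilTrunc a u x‖ ^ 2 := by
    have hm : MemLp (fun x ↦ weilTrunc a u (x + t) - weilTrunc a u x) 2 :=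
      (hv2.comp_measurePreserving (measurePreserving_add_right volume t)).sub hv2
    exact (memLp_two_iff_integrable_sq_norm hm.1).1 hm
  have hind : Integrable (S.indicator fun y ↦ ‖weilTrunc a u y‖ ^ 2) := hi2.indicator hSm
  -- the shell integral: `∫_S ‖ũ‖² ≤ K² · vol(S) ≤ K² · 4|t|`
  have hvol : volume.real S ≤ 4 * |t| := by
    have := stub_commutatorBound_volume_real_shell_le a (h - |t|) (h + |t|)
    have e : max (h + |t| - (h - |t|)) 0 = 2 * |t| := by
      rw [max_eq_left (by linarith [abs_nonneg t])]; ring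
    rw [e] at this
    linarith
  have hshell : ∫ x, S.indicator (fun y ↦ ‖weilTrunc a u y‖ ^ 2) x ≤ K ^ 2 * (4 * |t|) := by
    rw [integral_indicator hSm]
    have hb : ∀ᵐ x ∂(volume.restrict S), ‖(‖weilTrunc a u x‖ ^ 2 : ℝ)‖ ≤ K ^ 2 := by
      refine ae_restrict_of_ae ?_
      filter_upwards [hK] with x hx
      rw [Real.norm_of_nonneg (by positivity)]
      have h1 : ‖weilTrunc a u x‖ ≤ K := (norm_weilTrunc_le x).trans hx
      exact pow_le_pow_left₀ (norm_nonneg _) h1 2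
    have := norm_setIntegral_le_of_norm_le_const_ae
      (lt_top_iff_ne_top.2 (stub_commutatorBound_volume_shell_ne_top a (h - |t|) (h + |t|))) hb
    rw [Real.norm_of_nonneg (setIntegral_nonneg hSm fun _ _ ↦ by positivity)] at this
    exact this.trans (mul_le_mul_of_nonneg_left hvol (by positivity))
  unfold weilIncrement
  calc ∫ x, ‖weilEdgeLayer a u h (x + t) - weilEdgeLayer a u h x‖ ^ 2
      ≤ ∫ x, (2 * ‖weilTrunc a u (x + t) - weilTrunc a u x‖ ^ 2 +
          2 * S.indicator (fun y ↦ ‖weilTrunc a u y‖ ^ 2) x) :=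
        integral_mono_of_nonneg (Eventually.of_forall fun _ ↦ by positivity)
          ((hd2.const_mul 2).add (hind.const_mul 2))
          (Eventually.of_forall fun x ↦ norm_sq_sub_weilEdgeLayer_le h t x)
    _ = 2 * (∫ x, ‖weilTrunc a u (x + t) - weilTrunc a u x‖ ^ 2) +
          2 * ∫ x, S.indicator (fun y ↦ ‖weilTrunc a u y‖ ^ 2) x := by
        rw [integral_add (hd2.const_mul 2) (hind.const_mul 2), integral_const_mul,
          integral_const_mul]
    _ ≤ 2 * (∫ x, ‖weilTrunc a u (x + t) - weilTrunc a u x‖ ^ 2) + 8 * K ^ 2 * |t| := by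
        nlinarith [hshell]

/-! ## Finite energy of the layers -/

/-- `t ↦ D_t(σ_h)` is continuous (`σ_h ∈ L²` vanishes off `[−a, a]`). [folklore] -/
theorem continuous_weilIncrement_weilEdgeLayer (hu : IsWeilGroundState a u) (h : ℝ) :
    Continuous (weilIncrement (weilEdgeLayer a u h)) :=
  continuous_weilIncrement_of_memLp_window (b := a) (memLp_weilEdgeLayer hu h)
    fun x hx ↦ weilEdgeLayer_eq_zero_of_le_abs h (by
      by_contra hc
      exact hx (abs_le.1 (not_le.1 hc).le))

/-- **The edge layers of a ground state have finite energy**: for every ground state `u` of the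
window `a` and every depth `h`, `t ↦ ρ(t) D_t(σ_h)` is integrable on `(0, ∞)`. On `(0, 1]` the
integrand is `≤ 2ρ D_t(ũ) + 8K²` (`tρ(t) ≤ 1`), on `(1, ∞)` it is `≤ 4‖σ_h‖² ρ`.
[cite: Bombieri2000Weil, §4 Thm 3] -/
theorem integrableOn_arch_weilEdgeLayer (hu : IsWeilGroundState a u) (h : ℝ) :
    IntegrableOn (fun t ↦ weilArchDensity t * weilIncrement (weilEdgeLayer a u h) t) (Ioi 0) := by
  obtain ⟨K, -, hK⟩ := exists_ae_norm_le hu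
  have hσ2 := memLp_weilEdgeLayer hu h
  have hmeas : AEStronglyMeasurable
      (fun t ↦ weilArchDensity t * weilIncrement (weilEdgeLayer a u h) t) volume :=
    (measurable_weilArchDensity.mul
      (continuous_weilIncrement_weilEdgeLayer hu h).measurable).aestronglyMeasurable
  have hfinU : IntegrableOn
      (fun t ↦ weilArchDensity t * weilIncrement (weilTrunc a u) t) (Ioi 0) :=
    (stub_groundStateEnergy a _ (isWeilGroundState_weilTrunc hu)).1
  have hnn : ∀ t, 0 < t → 0 ≤ weilArchDensity t * weilIncrement (weilEdgeLayer a u h) t :=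
    fun t ht ↦ mul_nonneg (weilArchDensity_pos ht).le (weilIncrement_nonneg _ _)
  rw [← Ioc_union_Ioi_eq_Ioi zero_le_one]
  refine IntegrableOn.union ?_ ?_
  · -- near range `(0, 1]`
    have hdom : IntegrableOn (fun t ↦ 2 * (weilArchDensity t * weilIncrement (weilTrunc a u) t) +
        8 * K ^ 2) (Ioc 0 1) :=
      ((hfinU.mono_set Ioc_subset_Ioi_self).const_mul 2).add
        (integrableOn_const (measure_Ioc_lt_top.ne))
    refine Integrable.mono' hdom hmeas.restrict ?_
    filter_upwards [ae_restrict_mem measurableSet_Ioc] with t ht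
    rw [Real.norm_of_nonneg (hnn t ht.1)]
    have hρ0 := (weilArchDensity_pos ht.1).le
    have htρ : |t| * weilArchDensity t ≤ 1 := by
      rw [abs_of_pos ht.1]
      have := stub_commutatorBound_rho_le_inv ht.1 ht.2
      calc t * weilArchDensity t ≤ t * (1 / t) := mul_le_mul_of_nonneg_left this ht.1.le
        _ = 1 := by rw [mul_one_div, div_self ht.1.ne']
    calc weilArchDensity t * weilIncrement (weilEdgeLayer a u h) t
        ≤ weilArchDensity t * (2 * weilIncrement (weilTrunc a u) t + 8 * K ^ 2 * |t|) :=
          mul_le_mul_of_nonneg_left (weilIncrement_weilEdgeLayer_le hu hK h t) hρ0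
      _ = 2 * (weilArchDensity t * weilIncrement (weilTrunc a u) t) +
            8 * K ^ 2 * (|t| * weilArchDensity t) := by ring
      _ ≤ 2 * (weilArchDensity t * weilIncrement (weilTrunc a u) t) + 8 * K ^ 2 := by
          nlinarith [htρ, sq_nonneg K]
  · -- far range `(1, ∞)`
    have hdom : IntegrableOn
        (fun t ↦ (4 * ∫ x, ‖weilEdgeLayer a u h x‖ ^ 2) * weilArchDensity t) (Ioi 1) :=
      (integrableOn_weilArchDensity_Ioi one_pos).const_mul _
    refine Integrable.mono' hdom hmeas.restrict ?_
    filter_upwards [ae_restrict_mem measurableSet_Ioi] with t ht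
    have ht0 : 0 < t := one_pos.trans ht
    rw [Real.norm_of_nonneg (hnn t ht0), mul_comm]
    exact mul_le_mul_of_nonneg_right (stub_barrierEnergy_weilIncrement_le_four hσ2 t)
      (weilArchDensity_pos ht0).le

/-- Eventual form used by the limit argument. [folklore] -/
theorem eventually_integrableOn_arch_weilEdgeLayer (hu : IsWeilGroundState a u) :
    ∀ᶠ h in 𝓝[>] (0 : ℝ),
      IntegrableOn (fun t ↦ weilArchDensity t * weilIncrement (weilEdgeLayer a u h) t) (Ioi 0) :=
  Eventually.of_forall fun h ↦ integrableOn_arch_weilEdgeLayer hu h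

end Summit.RiemannHypothesis.RiemannHypothesis.Theorems.PfPersistence

end
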